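import Mathlib.Analysis.Complex.CauchyIntegral
import Mathlib.Analysis.Analytic.IsolatedZeros
import Mathlib.Analysis.SpecialFunctions.Pow.Real
import Literature.NumberTheory.Transcendental.SchneiderCuspAuxPoly
import Literature.NumberTheory.Transcendental.SchneiderCuspCounting
import Literature.NumberTheory.Transcendental.SchneiderCuspEngine
import HarnessLib

/-!
# Integer points of a transcendental germ at a cusp have zero lower logarithmic density

**Theorem** (`frequently_card_le_mul_log`). Let `e ≥ 1`, `A ∈ ℂ[w]`, and let `g` be analytic at
`0` and TRANSCENDENTAL over `ℂ(z)` (no non-zero `P ∈ ℂ[X, Y]` with `P(z, g z) = 0` near `0`).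
Then the set `S = {N ∈ ℕ : A(N^{1/e}) + g(N^{-1/e}) ∈ ℤ}` of integer points of the germ
`Φ(w) = A(w) + g(1/w)` along the ray `w = N^{1/e}` has zero lower logarithmic density, in the
junk-free form `∀ ε > 0, ∃ᶠ X, #(S ∩ [0, X]) ≤ ε log X`.

This is sharp in the hypothesis: for ALGEBRAIC `g` (Pell conics, `A = √2 w`,
`g(t) = (√(2 + t²) - √2)/t`, hits `2N² + 1 = L²`) there are `≍ log X` integer points.

**Proof** (Schneider's integer-valued-function method in Pólya form — Schneider 1949,
Waldschmidt 1978 — anchored by the ACCUMULATION of the sample points `σ_N = N^{-1/e}` at the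
cusp instead of an arithmetic lower bound). Suppose `#(S ∩ [0,X]) > ε log X` for `X ≥ X₁`.
With `d = deg A`, `s = e + d`, `Ψ(σ) = Â(σ) + σ^d g(σ)` (`Â` the reversed jet) holomorphic on
`|σ| < r₁`, `ρ = min(r₁,1)/2`, `C₀ = max(1, sup_{|σ| ≤ ρ} |Ψ|)`, choose `Y₀` large at a
near-record-low of `#(S∩[0,X])/log X` (`SchneiderCuspCounting.exists_near_record_low`), put
`n₀ = #(S ∩ [0,Y₀])`, `k = ⌊n₀/(128 s²)⌋ ≥ 16`, `D = 8 s k`, `T = 8 s² k`, `m = 32 s² k²`,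
`Y = Y₀^k`. Siegel's lemma (Mathlib's `Int.Matrix.exists_ne_zero_int_vec_norm_le`, `D²`
unknowns, `m = D²/2` equations, exponent `1`) gives `a ∈ ℤ^{D×D} ∖ 0`,
`|a| ≤ D² C₀^D Y^{T/e}`, with `V_N := ∑ a_{ij} Nⁱ L_Nʲ = 0` at `m` hits `N ∈ (Y₀, Y]`
(`L_N = Φ(N^{1/e}) ∈ ℤ`, `|L_N| ≤ C₀ N^{d/e}`). The auxiliary function
`F̂(σ) = P_a(σ, g σ)`, `P_a = ∑ a_{ij} X^{T-ei-dj} (Â + X^d Y)^j`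
(`SchneiderCuspAuxPoly`), is holomorphic on `|σ| < r₁`, `|F̂| ≤ B = D⁴ C₀^{2D} Y^{T/e}` on
`|σ| = ρ`, and `F̂(σ_N) = σ_N^T V_N` at hits (`σ_N^{-e} = N` exactly). By strong induction every
hit `K > Y₀` has `V_K = 0`: the crude Schwarz lemma on `|σ| ≤ ρ` with the zeros already known
(`SchneiderCuspExtrapolation.norm_le_at_sample`) gives `|V_K| ≤ K^{T/e} B (2/(ρ Y₀^{1/e}))^Z`,
and `< 1` by `phase_one_neg` (`K ≤ Y`, `Z = m`) resp. `phase_two_neg` (`K > Y`,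
`Z = #(S ∩ (Y₀, K)) ≥ n₀ log(K-1)/(2 log Y₀) - n₀`). The hits are unbounded, so the zeros
`σ_K → 0` of `F̂` accumulate: `F̂ ≡ 0` near `0` (identity theorem), i.e. `P_a(z, g z) = 0` near
`0` with `P_a ≠ 0` (`cuspAux_ne_zero`) — contradicting transcendence.

The hypothesis `g 0 = 0` of the usual normalisation is not needed and not assumed. `N = 0`
contributes at most one junk point (`0^{1/e} = 0`, `0⁻¹ = 0`).

## References

* Th. Schneider, Ein Satz über ganzwertige Funktionen als Prinzip für Transzendenzbeweise,
  *Math. Ann.* 121 (1949) 131–140.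
* M. Waldschmidt, Pólya's theorem by Schneider's method, *Acta Math. Acad. Sci. Hungar.* 31
  (1978) 21–25.
* D. Masser, *Auxiliary Polynomials in Number Theory*, Cambridge Tracts 207 (2016), Ch. 9.
-/

noncomputable section

open Filter Metric Finset MvPolynomial
open scoped Topology

namespace Literature.NumberTheory.Transcendental

/-- **Zero lower logarithmic density of the integer points of a transcendental germ at a cusp**
(Schneider's method in Pólya form; see the module docstring for the statement and the proof).
For `e ≥ 1`, `A ∈ ℂ[w]`, `g` analytic at `0` and transcendental over `ℂ(z)`, and every `ε > 0`:
frequently in `X`, `#{N ≤ X : A(N^{1/e}) + g(N^{-1/e}) ∈ ℤ} ≤ ε log X`. [folklore] -/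
theorem frequently_card_le_mul_log (e : ℕ) (he : 0 < e) (A : Polynomial ℂ) (g : ℂ → ℂ)
    (hg : AnalyticAt ℂ g 0)
    (htr : ¬ ∃ P : MvPolynomial (Fin 2) ℂ, P ≠ 0 ∧
        ∀ᶠ z in 𝓝 (0 : ℂ), MvPolynomial.eval ![z, g z] P = 0)
    (ε : ℝ) (hε : 0 < ε) :
    ∃ᶠ X : ℕ in atTop, (Nat.card {N : ℕ | N ≤ X ∧ ∃ L : ℤ,
        A.eval ((((N : ℝ) ^ ((e : ℝ)⁻¹) : ℝ) : ℂ)) +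
          g ((((N : ℝ) ^ ((e : ℝ)⁻¹) : ℝ) : ℂ))⁻¹ = L} : ℝ) ≤ ε * Real.log X := by
  classical
  /- ### notation: ray points, hits, counting function -/
  set w : ℕ → ℝ := fun N => (N : ℝ) ^ ((e : ℝ)⁻¹) with hw_def
  set hit : ℕ → Prop := fun N => ∃ L : ℤ,
    A.eval (((w N : ℝ)) : ℂ) + g (((w N : ℝ) : ℂ))⁻¹ = L with hhit_def
  set cnt : ℕ → ℕ := fun X => ((Iic X).filter hit).card with hcnt_def
  have hcard : ∀ X : ℕ, Nat.card {N : ℕ | N ≤ X ∧ ∃ L : ℤ,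
      A.eval ((((N : ℝ) ^ ((e : ℝ)⁻¹) : ℝ) : ℂ)) +
        g ((((N : ℝ) ^ ((e : ℝ)⁻¹) : ℝ) : ℂ))⁻¹ = L} = cnt X := fun X =>
    natCard_setOf_le_and_eq hit X
  suffices hmain : ∃ᶠ X : ℕ in atTop, (cnt X : ℝ) ≤ ε * Real.log X by
    refine hmain.mono fun X hX => ?_
    rw [hcard X]
    exact hX
  by_contra hcon
  rw [Filter.not_frequently] at hcon
  obtain ⟨X₁, hX₁'⟩ := Filter.eventually_atTop.mp hcon
  have hX₁ : ∀ X, X₁ ≤ X → ε * Real.log X < cnt X := fun X hX => not_le.mp (hX₁' X hX)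
  /- ### the ray points `w N = N^{1/e}` -/
  have heinv : 0 < (e : ℝ)⁻¹ := by positivity
  have hepos : (0 : ℝ) < e := by exact_mod_cast he
  have hw_nonneg : ∀ N, 0 ≤ w N := fun N => Real.rpow_nonneg (Nat.cast_nonneg N) _
  have hw_pos : ∀ N, 0 < N → 0 < w N := fun N hN => Real.rpow_pos_of_pos (by exact_mod_cast hN) _
  have hw_pow : ∀ N, w N ^ e = N := fun N => Real.rpow_inv_natCast_pow (Nat.cast_nonneg N) he.ne'
  have hw_mono : ∀ N N' : ℕ, N ≤ N' → w N ≤ w N' := fun N N' h =>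
    Real.rpow_le_rpow (Nat.cast_nonneg _) (by exact_mod_cast h) heinv.le
  have hw_one : ∀ N, 1 ≤ N → 1 ≤ w N := fun N hN => by
    have h := hw_mono 1 N hN
    simpa [hw_def] using h
  have hw_log : ∀ N, 0 < N → Real.log (w N) = (e : ℝ)⁻¹ * Real.log N := fun N hN =>
    Real.log_rpow (by exact_mod_cast hN) _
  have hw_powk : ∀ N j : ℕ, w (N ^ j) = w N ^ j := fun N j => by
    simp only [hw_def]
    push_cast
    rw [← Real.rpow_natCast, ← Real.rpow_mul (Nat.cast_nonneg N), mul_comm,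
      Real.rpow_mul (Nat.cast_nonneg N), Real.rpow_natCast]
  have hw_inj : Function.Injective w := fun N N' h => by
    have h' := congrArg (· ^ e) h
    simp only [hw_pow] at h'
    exact_mod_cast h'
  have hw_two : ∀ K, 2 ≤ K → w K ≤ 2 * w (K - 1) := by
    intro K hK
    have h2 : w K ≤ w (2 * (K - 1)) := hw_mono _ _ (by omega)
    have h3 : w (2 * (K - 1)) = (2 : ℝ) ^ ((e : ℝ)⁻¹) * w (K - 1) := by
      simp only [hw_def]; push_cast
      rw [Real.mul_rpow (by norm_num) (by positivity)]
    have h4 : (2 : ℝ) ^ ((e : ℝ)⁻¹) ≤ 2 := by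
      calc (2 : ℝ) ^ ((e : ℝ)⁻¹) ≤ (2 : ℝ) ^ (1 : ℝ) :=
            Real.rpow_le_rpow_of_exponent_le (by norm_num)
              (inv_le_one_of_one_le₀ (by exact_mod_cast he))
        _ = 2 := Real.rpow_one 2
    calc w K ≤ (2 : ℝ) ^ ((e : ℝ)⁻¹) * w (K - 1) := h3 ▸ h2
      _ ≤ 2 * w (K - 1) := mul_le_mul_of_nonneg_right h4 (hw_nonneg _)
  have hw_tend : Tendsto w atTop atTop :=
    (tendsto_rpow_atTop heinv).comp tendsto_natCast_atTop_atTop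
  /- ### analytic data: `g` on `|z| < r₁`, the disc `|z| ≤ ρ`, `Ψ` and `C₀` -/
  obtain ⟨r₁, hr₁, hgan⟩ := hg.exists_ball_analyticOnNhd
  have hgr : DifferentiableOn ℂ g (ball 0 r₁) := hgan.differentiableOn
  set d : ℕ := A.natDegree with hd_def
  set s₀ : ℕ := e + d with hs₀_def
  have hs₀ : 1 ≤ s₀ := by omega
  set ρ : ℝ := min r₁ 1 / 2 with hρ_def
  have hρ : 0 < ρ := by positivity
  have hρr : ρ < r₁ := by
    have := min_le_left r₁ 1
    rw [hρ_def]; linarith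
  have hρ1 : ρ ≤ 1 := by
    have := min_le_right r₁ 1
    rw [hρ_def]; linarith
  have hsub : closedBall (0 : ℂ) ρ ⊆ ball 0 r₁ := closedBall_subset_ball hρr
  set Arf : ℂ → ℂ := fun x => ∑ l ∈ range (d + 1), A.coeff l * x ^ (d - l) with hArf_def
  set Ψ : ℂ → ℂ := fun z => Arf z + z ^ d * g z with hΨ_def
  have hΨc : ContinuousOn Ψ (closedBall 0 ρ) := by
    refine ContinuousOn.add (Continuous.continuousOn (by simp only [hArf_def]; fun_prop)) ?_
    exact (continuousOn_id.pow d).mul (hgr.continuousOn.mono hsub)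
  obtain ⟨Cb, hCb⟩ := (isCompact_closedBall (0 : ℂ) ρ).exists_bound_of_continuousOn hΨc
  set C₀ : ℝ := max Cb 1 with hC₀_def
  have hC₀1 : 1 ≤ C₀ := le_max_right _ _
  have hC₀0 : 0 < C₀ := by positivity
  have hΨC₀ : ∀ z ∈ closedBall (0 : ℂ) ρ, ‖Ψ z‖ ≤ C₀ := fun z hz =>
    (hCb z hz).trans (le_max_left _ _)
  set lC : ℝ := Real.log C₀ with hlC_def
  have hlC : 0 ≤ lC := Real.log_nonneg hC₀1
  set lρ : ℝ := Real.log (2 / ρ) with hlρ_def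
  have h2ρ : 2 ≤ 2 / ρ := by
    rw [le_div_iff₀ hρ]; linarith
  have hlρ : 0 ≤ lρ := Real.log_nonneg (by linarith)
  set Λthr : ℝ := 2 * lρ + lC + 2 with hΛthr_def
  /- ### the scale `Y₀` (near-record-low of `cnt X / log X` beyond a threshold `M`) -/
  set Lbig : ℝ := max ((e : ℝ) * Λthr) (2048 * (s₀ : ℝ) ^ 2 / ε) with hLbig_def
  set M : ℕ := max X₁ (⌈Real.exp Lbig⌉₊ + 2) with hM_def
  have hMX₁ : X₁ ≤ M := le_max_left _ _
  have hM2 : 2 ≤ M := le_trans (by omega) (le_max_right _ _)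
  have hMexp : ∀ Y : ℕ, M ≤ Y → Lbig ≤ Real.log Y := by
    intro Y hY
    have h0 : ⌈Real.exp Lbig⌉₊ ≤ Y := by
      have := le_trans (le_max_right _ _) hY
      omega
    have h2 : Real.exp Lbig ≤ Y := (Nat.le_ceil _).trans (by exact_mod_cast h0)
    have hYpos : (0 : ℝ) < Y := (Real.exp_pos _).trans_le h2
    exact (Real.le_log_iff_exp_le hYpos).mpr h2
  have hlogpos : ∀ X : ℕ, 2 ≤ X → 0 < Real.log X := fun X hX =>
    Real.log_pos (by exact_mod_cast hX)
  set r : ℕ → ℝ := fun X => (cnt X : ℝ) / Real.log X with hr_def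
  have hrε : ∀ X, M ≤ X → ε ≤ r X := by
    intro X hX
    have hl := hlogpos X (hM2.trans hX)
    rw [hr_def, le_div_iff₀ hl]
    exact (hX₁ X (hMX₁.trans hX)).le
  obtain ⟨Y₀, hY₀M, hrec⟩ := exists_near_record_low r hε M hrε
  have hY₀2 : 2 ≤ Y₀ := hM2.trans hY₀M
  have hY₀pos : 0 < Y₀ := by omega
  have hℓ₀ : 0 < Real.log Y₀ := hlogpos Y₀ hY₀2
  set n₀ : ℕ := cnt Y₀ with hn₀_def
  have hrec' : ∀ X, Y₀ ≤ X → (n₀ : ℝ) * Real.log X < 2 * cnt X * Real.log Y₀ := by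
    intro X hX
    have hlX := hlogpos X (hY₀2.trans hX)
    have h : (n₀ : ℝ) / Real.log Y₀ < 2 * (cnt X : ℝ) / Real.log X := by
      have := hrec X hX
      simp only [hr_def] at this
      rwa [mul_div_assoc]
    rwa [div_lt_div_iff₀ hℓ₀ hlX] at h
  -- the same in terms of `log (w X) = (log X)/e`
  have hrecw : ∀ X, Y₀ ≤ X →
      (n₀ : ℝ) * Real.log (w X) < 2 * ((Iic X).filter hit).card * Real.log (w Y₀) := by
    intro X hX
    have h := hrec' X hX
    rw [hw_log X (by omega), hw_log Y₀ hY₀pos]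
    have : (cnt X : ℝ) = ((Iic X).filter hit).card := rfl
    rw [← this]
    nlinarith
  /- ### `u₀ = Y₀^{1/e}`, `λ = log u₀` and the thresholds -/
  set u₀ : ℝ := w Y₀ with hu₀_def
  have hu₀pos : 0 < u₀ := hw_pos Y₀ hY₀pos
  set lam : ℝ := Real.log u₀ with hlam_def
  have hlam_eq : Real.log Y₀ = e * lam := by
    rw [hlam_def, hu₀_def, hw_log Y₀ hY₀pos]
    field_simp
  have hLY₀ := hMexp Y₀ hY₀M
  have hlam_ge : 2 * lρ + lC + 2 ≤ lam := by
    have h1 : (e : ℝ) * Λthr ≤ Real.log Y₀ := (le_max_left _ _).trans hLY₀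
    rw [hlam_eq] at h1
    exact le_of_mul_le_mul_left h1 hepos
  have hu₀ge : 2 / ρ ≤ u₀ := by
    have h1 : lρ ≤ lam := by linarith
    rwa [hlρ_def, hlam_def, Real.log_le_log_iff (by positivity) hu₀pos] at h1
  have hu₀1 : 1 ≤ u₀ := by linarith
  have hn₀ε : ε * Real.log Y₀ < n₀ := hX₁ Y₀ (hMX₁.trans hY₀M)
  have hn₀big : (2048 : ℝ) * s₀ ^ 2 ≤ n₀ := by
    have h1 : 2048 * (s₀ : ℝ) ^ 2 / ε ≤ Real.log Y₀ := (le_max_right _ _).trans hLY₀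
    rw [div_le_iff₀ hε] at h1
    nlinarith
  have hn₀bigN : 2048 * s₀ ^ 2 ≤ n₀ := by exact_mod_cast hn₀big
  /- ### parameters -/
  set k : ℕ := n₀ / (128 * s₀ ^ 2) with hk_def
  have h128 : 0 < 128 * s₀ ^ 2 := by positivity
  have hk16 : 16 ≤ k := by
    rw [hk_def, Nat.le_div_iff_mul_le h128]
    linarith
  have hn₀k : 128 * s₀ ^ 2 * k ≤ n₀ := by
    rw [mul_comm]
    exact Nat.div_mul_le_self n₀ _
  have hk1 : 1 ≤ k := le_trans (by norm_num) hk16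
  set D : ℕ := 8 * s₀ * k with hD_def
  set T : ℕ := 8 * s₀ ^ 2 * k with hT_def
  set m : ℕ := 32 * s₀ ^ 2 * k ^ 2 with hm_def
  have hD1 : 1 ≤ D := by
    have : 1 ≤ 8 * s₀ * k := by nlinarith
    simpa [hD_def] using this
  have hDD : D * D = 2 * m := by
    simp only [hD_def, hm_def]; ring
  have hm0 : 0 < m := by positivity
  have hTij : ∀ ij : Fin D × Fin D, e * (ij.1 : ℕ) + d * (ij.2 : ℕ) ≤ T := by
    intro ij
    have hi : (ij.1 : ℕ) ≤ D := ij.1.is_lt.le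
    have hj : (ij.2 : ℕ) ≤ D := ij.2.is_lt.le
    calc e * (ij.1 : ℕ) + d * (ij.2 : ℕ) ≤ e * D + d * D :=
          add_le_add (Nat.mul_le_mul_left e hi) (Nat.mul_le_mul_left d hj)
      _ = T := by simp only [hD_def, hT_def, hs₀_def]; ring
  have hk16R : (16 : ℝ) ≤ k := by exact_mod_cast hk16
  have hn₀kR : (128 : ℝ) * s₀ ^ 2 * k ≤ n₀ := by exact_mod_cast hn₀k
  have hDR : (D : ℝ) = 8 * s₀ * k := by simp only [hD_def]; push_cast; ring
  have hmR : (m : ℝ) = 32 * s₀ ^ 2 * k ^ 2 := by simp only [hm_def]; push_cast; ring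
  /- ### `Y = Y₀^k` and the `m` equations -/
  set Y : ℕ := Y₀ ^ k with hY_def
  have hY₀Y : Y₀ ≤ Y := by
    calc Y₀ = Y₀ ^ 1 := (pow_one _).symm
      _ ≤ Y₀ ^ k := Nat.pow_le_pow_right hY₀pos hk1
  have hwY : w Y = u₀ ^ k := by rw [hY_def, hw_powk]
  have hlogY : Real.log Y = k * Real.log Y₀ := by
    rw [hY_def]; push_cast; exact Real.log_pow _ k
  have hcntY : (m : ℝ) + n₀ ≤ cnt Y := by
    have h := hrec' Y hY₀Y
    rw [hlogY] at h
    have h2 : (n₀ : ℝ) * k < 2 * cnt Y := by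
      have h' : (n₀ : ℝ) * k * Real.log Y₀ < 2 * cnt Y * Real.log Y₀ := by linarith
      exact lt_of_mul_lt_mul_right h' hℓ₀.le
    have hA : (32 : ℝ) * s₀ ^ 2 * k ^ 2 ≤ n₀ * k / 4 := by
      have := mul_le_mul_of_nonneg_right hn₀kR (show (0 : ℝ) ≤ k / 4 by positivity)
      linarith
    have hB : (n₀ : ℝ) ≤ n₀ * k / 4 := by
      have := mul_le_mul_of_nonneg_left (show (1 : ℝ) ≤ k / 4 by linarith) (Nat.cast_nonneg n₀)
      linarith
    rw [hmR]
    linarith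
  have hcardIoc : ((Ioc Y₀ Y).filter hit).card = cnt Y - n₀ := by
    have := card_filter_Iic_eq_add hit hY₀Y
    simp only [hcnt_def, hn₀_def]
    omega
  have hmle : m ≤ ((Ioc Y₀ Y).filter hit).card := by
    rw [hcardIoc]
    have : m + n₀ ≤ cnt Y := by exact_mod_cast hcntY
    omega
  obtain ⟨E, hEsub, hEcard⟩ := Finset.exists_subset_card_eq hmle
  have hEmem : ∀ N ∈ E, Y₀ < N ∧ N ≤ Y ∧ hit N := fun N hN => by
    have := hEsub hN
    simp only [mem_filter, mem_Ioc] at this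
    exact ⟨this.1.1, this.1.2, this.2⟩
  /- ### hit values `L N ∈ ℤ` and their size -/
  have hLex : ∃ L : ℕ → ℤ, ∀ N, hit N → A.eval ((w N : ℝ) : ℂ) + g (((w N : ℝ) : ℂ))⁻¹ = L N :=
    ⟨fun N => if h : hit N then h.choose else 0, fun N hN => by
      simp only [dif_pos hN]
      exact hN.choose_spec⟩
  obtain ⟨L, hL⟩ := hLex
  have hσpos : ∀ N, Y₀ < N → 0 < (w N)⁻¹ := fun N hN => inv_pos.mpr (hw_pos N (by omega))
  have hσle : ∀ N, Y₀ < N → (w N)⁻¹ ≤ u₀⁻¹ := fun N hN => inv_anti₀ hu₀pos (hw_mono _ _ hN.le)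
  have hu₀inv : u₀⁻¹ ≤ ρ / 2 := by
    rw [inv_le_comm₀ hu₀pos (by positivity), inv_div]
    exact hu₀ge
  have hσball : ∀ N, Y₀ < N → (((w N)⁻¹ : ℝ) : ℂ) ∈ closedBall (0 : ℂ) ρ := fun N hN => by
    rw [mem_closedBall_zero_iff, Complex.norm_real, Real.norm_eq_abs, abs_of_pos (hσpos N hN)]
    linarith [hσle N hN]
  have hσC : ∀ N, (((w N)⁻¹ : ℝ) : ℂ) = (((w N : ℝ) : ℂ))⁻¹ := fun N => Complex.ofReal_inv _
  -- `Ψ(σ_N) = σ_N^d L_N` at a hit `N > Y₀`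
  have hΨval : ∀ N, Y₀ < N → hit N →
      Arf (((w N)⁻¹ : ℝ) : ℂ) + (((w N)⁻¹ : ℝ) : ℂ) ^ d * g (((w N)⁻¹ : ℝ) : ℂ) =
        (((w N)⁻¹ : ℝ) : ℂ) ^ d * (L N : ℂ) := by
    intro N hN hhN
    have hwN : ((w N : ℝ) : ℂ) ≠ 0 := by exact_mod_cast (hw_pos N (by omega)).ne'
    rw [hσC N, hArf_def]
    dsimp only
    rw [revJet_eq_pow_mul_eval_inv A le_rfl (inv_ne_zero hwN), inv_inv, ← hL N hhN]
    ring
  have hLbound : ∀ N, Y₀ < N → hit N → |(L N : ℝ)| ≤ C₀ * w N ^ d := by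
    intro N hN hhN
    have hwNpos := hw_pos N (by omega)
    have h2 : ‖Ψ (((w N)⁻¹ : ℝ) : ℂ)‖ ≤ C₀ := hΨC₀ _ (hσball N hN)
    have h3 : Ψ (((w N)⁻¹ : ℝ) : ℂ) = (((w N)⁻¹ : ℝ) : ℂ) ^ d * (L N : ℂ) := hΨval N hN hhN
    rw [h3, norm_mul, norm_pow, Complex.norm_real, Complex.norm_intCast, Real.norm_eq_abs,
      abs_of_pos (hσpos N hN), inv_pow, inv_mul_le_iff₀ (pow_pos hwNpos d)] at h2
    linarith [h2]
  /- ### Siegel's lemma -/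
  have hwE : ∀ N ∈ E, 1 ≤ w N ∧ w N ≤ u₀ ^ k ∧ w N ^ e = N ∧ |(L N : ℝ)| ≤ C₀ * w N ^ d := by
    intro N hN
    obtain ⟨hN1, hN2, hN3⟩ := hEmem N hN
    exact ⟨hw_one N (by omega), hwY ▸ hw_mono _ _ hN2, hw_pow N, hLbound N hN1 hN3⟩
  obtain ⟨a, ha0, hEzero, haΛ⟩ := exists_cuspAux_coeffs hC₀1 (one_le_pow₀ hu₀1) w L E hEcard
    hDD hm0 hTij hwE
  set Λ : ℝ := (D * D : ℝ) * (C₀ ^ D * (u₀ ^ k) ^ T) with hΛ_def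
  have hΛpos : 0 < Λ := by positivity
  /- ### the auxiliary function `F = P_a(z, g z)` -/
  set Ar : MvPolynomial (Fin 2) ℂ := ∑ l ∈ range (d + 1), C (A.coeff l) * X 0 ^ (d - l)
    with hAr_def
  have hAr : ∀ x y : ℂ, eval ![x, y] Ar = Arf x := fun x y => eval_revJet A d x y
  set P : MvPolynomial (Fin 2) ℂ := ∑ ij : Fin D × Fin D, C (a ij : ℂ) *
      X 0 ^ (T - e * ij.1 - d * ij.2) * (Ar + X 0 ^ d * X 1) ^ (ij.2 : ℕ) with hP_def
  set F : ℂ → ℂ := fun z => eval ![z, g z] P with hF_def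
  have hFdiff : DifferentiableOn ℂ F (ball 0 r₁) := differentiableOn_eval_pair hgr P
  set B : ℝ := (D : ℝ) ^ 2 * Λ * C₀ ^ D with hB_def
  have hBpos : 0 < B := by positivity
  have hFsph : ∀ z ∈ sphere (0 : ℂ) ρ, ‖F z‖ ≤ B := by
    intro z hz
    have hz1 : ‖z‖ ≤ 1 := by rw [mem_sphere_zero_iff_norm.mp hz]; exact hρ1
    exact norm_eval_cuspAux_le a Ar Arf hAr hz1 hC₀1 (hΨC₀ z (sphere_subset_closedBall hz))
      hΛpos.le haΛ
  set V : ℕ → ℤ := fun N => ∑ ij : Fin D × Fin D,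
    a ij * (N : ℤ) ^ (ij.1 : ℕ) * L N ^ (ij.2 : ℕ) with hV_def
  have hFval : ∀ N, Y₀ < N → hit N →
      F (((w N)⁻¹ : ℝ) : ℂ) = (((w N)⁻¹ : ℝ) : ℂ) ^ T * (V N : ℂ) := by
    intro N hN hhN
    have hNpos : 0 < N := by omega
    have hσν : (((w N)⁻¹ : ℝ) : ℂ) ^ e * (N : ℂ) = 1 := by
      rw [hσC N, inv_pow, ← Complex.ofReal_pow, hw_pow N]
      push_cast
      exact inv_mul_cancel₀ (by exact_mod_cast hNpos.ne')
    simp only [hF_def, hP_def]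
    rw [eval_cuspAux_sample a Ar Arf hAr hTij hσν (hΨval N hN hhN), hV_def]
    push_cast
    rfl
  have hBeq : B = (D : ℝ) ^ 4 * C₀ ^ (2 * D) * u₀ ^ (k * T) := by
    simp only [hB_def, hΛ_def]
    ring
  have hlogB : Real.log B = 4 * Real.log (8 * s₀ * k : ℝ) + 2 * (8 * s₀ * k : ℝ) * lC +
      k * T * Real.log (w Y₀) := by
    rw [hBeq, hu₀_def, Real.log_mul (by positivity) (by positivity),
      Real.log_mul (by positivity) (by positivity), Real.log_pow, Real.log_pow, Real.log_pow,
      hlC_def]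
    push_cast
    rw [hDR]
  /- ### all hits beyond `Y₀` are zeros of `F`, which therefore accumulate at `0` -/
  have hallzero : ∀ K, Y₀ < K → hit K → V K = 0 :=
    cusp_hits_vanish hρ hρr hρ1 hFdiff hFsph hBpos w hw_pos hw_mono hw_inj hw_two hY₀pos
      (hw_powk Y₀ k) hu₀ge hit V hFval E hEmem hEzero rfl hrecw hs₀ hk16 hn₀k
      (hEcard.trans rfl) rfl hlC hlam_ge hlogB
  have hunb : ∀ Bd : ℕ, ∃ K, Bd < K ∧ hit K := exists_lt_of_log_lt_card hit hε hX₁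
  have hFan : AnalyticAt ℂ F 0 := hFdiff.analyticAt (ball_mem_nhds 0 hr₁)
  have hfreq : ∃ᶠ z in 𝓝[≠] (0 : ℂ), F z = 0 := by
    refine frequently_eq_zero_of_hits w hw_pos hw_tend hit hY₀pos hunb fun K hK hhK => ?_
    rw [hFval K hK hhK, hallzero K hK hhK]
    simp
  have hev : ∀ᶠ z in 𝓝 (0 : ℂ), F z = 0 := hFan.frequently_zero_iff_eventually_zero.mp hfreq
  exact htr ⟨P, cuspAux_ne_zero he hTij ha0 Ar Arf hAr, hev⟩

end Literature.NumberTheory.Transcendental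

end
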